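import Summits.QuantumAdvantage.QuantumAdvantage.Theorems.SosSandwichPseudoBoundedAAClassicalCorner
import Literature.Computability.Complexity.TribesFunction
import Literature.Computability.Complexity.PromiseRPAmplification
import Mathlib.Algebra.Order.Ring.Pow
import HarnessLib

/-!
# Crux `PseudoBoundedAA` (stmt-QuantumAdvantage-15237, route SosSandwich) — the TRIBES CALIBRATOR of the classical corner:
# a single depth-`T` Boolean decision tree with `Var ≥ 3/16` and every influence `≤ 2·log₂T / T`

Support file (`--supports stmt-QuantumAdvantage-15237`) for the rank-2 crux PB-AA.  The tree's CLASSICAL CORNER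
(`Theorems/SosSandwichPseudoBoundedAAClassicalCorner.lean`) proves that on the sub-cone `R_T ⊆ K_T` of acceptance
probabilities of randomized classical `T`-query algorithms (probability mixtures of decision trees of depth `≤ T`) every
law `16·Var[p]² ≤ T²·maxᵢ Infᵢ[p]` holds, and on several sub-corners (nonadaptive, block-product, single Boolean tree) the
`T`-exponent drops to `1`.  This file supplies the standard witness that the `T`-exponent can NOT drop below `1`, even for a
single total Boolean function: the Ben-Or–Linial TRIBES function `Tribes_{w,s}` with `s = 2^w` tribes (O'Donnell 2014 §4.2),
read through the tree's cube vocabulary (`evalBool`, `boolVariance`, `influence`, `DecisionTree`):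

* §1 `exists_mixture_of_boolean` — every total Boolean `f` on `N` bits is (the `0/1` values of) a polynomial of degree `≤ N`
  that is a one-tree "mixture" of depth `≤ N` (so `f ∈ R_N ⊆ K_N`);
* §2 `boolVariance_eq_of_boolean`, `influence_eq_card_of_boolean` — for `{0,1}`-valued `p`: `Var[p] = P(1 − P)` with
  `P = #{p = 1}/2^N`, and `Infᵢ[p] = #{x : p(x^{(i↦1)}) ≠ p(x^{(i↦0)})}/2^N`;
* §3 tribes on `Fin (s·w)` (transport along `finProdFinEquiv`): `#{Tribes = 0} = (2^w − 1)^s`, `#{i pivotal} ≤ 2(2^w)^{s−1}`;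
* §4 the elementary bounds `1/4 ≤ (1 − 2^{−w})^{2^w} ≤ 1/2` (Bernoulli twice; the upper bound is the tree's
  `Literature.Computability.Complexity.one_sub_inv_pow_le_half`);
* §5 **`exists_tribes_calibrator`** — for every `w ≥ 1`, on `N = 2^w·w` bits there is a polynomial `p`, `{0,1}`-valued on
  the cube, equal on the cube to ONE decision tree of depth `≤ N` (hence a mixture of depth-`≤ T` trees with `T = N`, and
  pseudo-bounded of order `N`), with `Var[p] ≥ 3/16` and EVERY `Infᵢ[p] ≤ 2/2^w = 2w/N`.

Consequence (drawn in `Theorems/SosSandwichPseudoBoundedAAClassicalCornerExponents.lean`): a law `C·Var^a/T^b ≤ maxInf`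
on the classical corner forces `b ≥ 1`; together with the `T = 1` averaging family (`a ≥ 2`) and the proved `(2,2)` law,
the admissible exponent region of `R_T` is pinned between `{a ≥ 2, b ≥ 2}` and `{a ≥ 2, b ≥ 1}`.

Honest label: calibration of a corner of an open conjecture; no registered stub, crux or summit is closed.
Sources: M. Ben-Or, N. Linial, FOCS 1985 (tribes); R. O'Donnell, *Analysis of Boolean Functions* (CUP 2014) §4.2;
R. O'Donnell, M. Saks, O. Schramm, R. Servedio, FOCS 2005 (tightness of OSSS up to the logarithm, via tribes).
-/

set_option linter.dupNamespace false

noncomputable section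

namespace Summit.QuantumAdvantage.QuantumAdvantage.Theorems.SosSandwich

open Finset Function
open Literature.Computability.Complexity Literature.Computability.QuantumComplexity

namespace ClassicalCornerCalibration

variable {N : ℕ}

/-! ### §1 Total Boolean functions are one-tree mixtures of depth `≤ N` -/

/-- **Every total Boolean function lies in the classical corner `R_N`.** For `f : {0,1}^N → {0,1}` there is a real
polynomial `p` of total degree `≤ N` taking the values of `f` on the cube, which is on the cube the (trivial, one-tree)
mixture of a decision tree of depth `≤ N` computing `f`. [cite: Wolf2002, §2.1] -/
theorem exists_mixture_of_boolean (f : (Fin N → Bool) → Bool) :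
    ∃ p : MvPolynomial (Fin N) ℝ, p.totalDegree ≤ N ∧ (∀ x, evalBool p x = if f x = true then (1 : ℝ) else 0) ∧
      ∃ (m : ℕ) (w : Fin m → ℝ) (t : Fin m → DecisionTree N),
        (∀ k, 0 ≤ w k) ∧ ∑ k, w k = 1 ∧ (∀ k, (t k).depth ≤ N) ∧
          ∀ x : Fin N → Bool, evalBool p x = ∑ k, w k * (if (t k).eval x = true then (1 : ℝ) else 0) := by
  obtain ⟨t, ht, hd⟩ := DecisionTree.exists_computes_depth_le f
  obtain ⟨q, hqd, hqe⟩ := ClassicalCorner.exists_poly_of_decisionTree t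
  refine ⟨q, hqd.trans hd, fun x => by rw [hqe x, ht x], 1, fun _ => 1, fun _ => t, fun _ => zero_le_one,
    by simp, fun _ => hd, fun x => ?_⟩
  rw [hqe x]
  simp

/-! ### §2 Variance and influences of a `{0,1}`-valued polynomial as counts -/

/-- For a `{0,1}`-valued function on the cube, `Σ F = #{F = 1}`. [folklore] -/
theorem sum_eq_card_of_boolean (F : (Fin N → Bool) → ℝ) (f : (Fin N → Bool) → Bool)
    (hF : ∀ x, F x = if f x = true then (1 : ℝ) else 0) :
    ∑ x, F x = ((Finset.univ.filter fun x => f x = true).card : ℝ) := by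
  rw [Finset.sum_congr rfl fun x _ => hF x, Finset.sum_boole]

/-- **`Var[p] = P·(1 − P)`** for a polynomial taking the `0/1` values of `f` on the cube, `P = #{f = 1}/2^N`.
[cite: ODonnell2014, §1.4] -/
theorem boolVariance_eq_of_boolean (p : MvPolynomial (Fin N) ℝ) (f : (Fin N → Bool) → Bool)
    (hp : ∀ x, evalBool p x = if f x = true then (1 : ℝ) else 0) :
    boolVariance p =
      ((Finset.univ.filter fun x => f x = true).card : ℝ) / (2 : ℝ) ^ N *
        (1 - ((Finset.univ.filter fun x => f x = true).card : ℝ) / (2 : ℝ) ^ N) := by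
  have h2 : (0 : ℝ) < (2 : ℝ) ^ N := by positivity
  have key := BooleanCorner.sum_sq_sub_sq_sum_eq p
  have hsq : ∑ x, evalBool p x * evalBool p x = ∑ x, evalBool p x := by
    refine Finset.sum_congr rfl fun x _ => ?_
    rw [hp x]; split_ifs <;> norm_num
  rw [hsq, sum_eq_card_of_boolean (evalBool p) f hp] at key
  set K : ℝ := ((Finset.univ.filter fun x => f x = true).card : ℝ)
  have hv : boolVariance p = ((2 : ℝ) ^ N * K - K * K) / ((2 : ℝ) ^ N * (2 : ℝ) ^ N) := by
    rw [key]; field_simp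
  rw [hv]
  field_simp

/-- **`Infᵢ[p] = #{x : i pivotal}/2^N`** for a polynomial taking the `0/1` values of `f` on the cube (pivotal in the
fixed-bit form `f(x^{(i↦1)}) ≠ f(x^{(i↦0)})`). [cite: ODonnell2014, Def. 2.13] -/
theorem influence_eq_card_of_boolean (p : MvPolynomial (Fin N) ℝ) (f : (Fin N → Bool) → Bool)
    (hp : ∀ x, evalBool p x = if f x = true then (1 : ℝ) else 0) (i : Fin N) :
    influence i p =
      ((Finset.univ.filter fun x => f (update x i true) ≠ f (update x i false)).card : ℝ) / (2 : ℝ) ^ N := by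
  unfold influence boolAvg
  congr 1
  rw [← Finset.sum_boole]
  refine Finset.sum_congr rfl fun x _ => ?_
  -- pointwise: `(p x − p xⁱ)² = [f(x^{i→1}) ≠ f(x^{i→0})]`
  have hflip : (evalBool p x - evalBool p (flipBit i x)) ^ 2 =
      (evalBool p (update x i true) - evalBool p (update x i false)) ^ 2 := by
    dsimp only [flipBit]
    rcases Bool.eq_false_or_eq_true (x i) with hx | hx
    · have hu : update x i true = x := by rw [← hx]; exact update_eq_self i x
      rw [hu, hx, Bool.not_true]
    · have hu : update x i false = x := by rw [← hx]; exact update_eq_self i x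
      rw [hu, hx, Bool.not_false, ← neg_sub, neg_sq]
  show (evalBool p x - evalBool p (flipBit i x)) ^ 2 = _
  rw [hflip, hp, hp]
  cases f (update x i true) <;> cases f (update x i false) <;> simp

/-! ### §3 Tribes on `Fin (s·w)` -/

variable {s w : ℕ}

/-- Tribes transported to `Fin (s·w)` along `finProdFinEquiv`: the zero count is `(2^w − 1)^s`. [cite: ODonnell2014, §4.2] -/
theorem card_filter_tribesFin_eq_false (s w : ℕ) :
    ((Finset.univ : Finset (Fin (s * w) → Bool)).filter
        (fun x => tribes s w (fun q => x (finProdFinEquiv q)) = false)).card = (2 ^ w - 1) ^ s := by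
  classical
  rw [← card_filter_tribes_eq_false s w, ← Fintype.card_subtype, ← Fintype.card_subtype]
  refine Fintype.card_congr (Equiv.subtypeEquiv
    ((finProdFinEquiv (m := s) (n := w)).arrowCongr (Equiv.refl Bool)).symm fun x => ?_)
  rfl

/-- Fixing bit `i` of the transported input is fixing bit `finProdFinEquiv⁻¹ i` of the product-indexed input. [folklore] -/
theorem tribesFin_update (x : Fin (s * w) → Bool) (i : Fin (s * w)) (b : Bool) :
    tribes s w (fun q => update x i b (finProdFinEquiv q)) =
      tribes s w (update (fun q => x (finProdFinEquiv q)) (finProdFinEquiv.symm i) b) := by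
  congr 1
  exact update_comp_equiv x finProdFinEquiv i b

/-- The number of inputs at which bit `i` is pivotal for the transported tribes function is at most `2·(2^w)^{s−1}`
(every influence of tribes is `≤ 2^{1−w}`). [cite: ODonnell2014, §4.2] -/
theorem card_filter_tribesFin_pivotal_le (i : Fin (s * w)) :
    ((Finset.univ : Finset (Fin (s * w) → Bool)).filter
        (fun x => tribes s w (fun q => update x i true (finProdFinEquiv q)) ≠
          tribes s w (fun q => update x i false (finProdFinEquiv q)))).card ≤ 2 * (2 ^ w) ^ (s - 1) := by
  classical
  obtain ⟨⟨t₀, j₀⟩, hsplit⟩ : ∃ q : Fin s × Fin w, finProdFinEquiv.symm i = q := ⟨_, rfl⟩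
  have hle := card_filter_tribes_pivotal_le (s := s) (w := w) t₀ j₀
  refine le_trans (le_of_eq ?_) hle
  rw [← Fintype.card_subtype, ← Fintype.card_subtype]
  refine Fintype.card_congr (Equiv.subtypeEquiv
    ((finProdFinEquiv (m := s) (n := w)).arrowCongr (Equiv.refl Bool)).symm fun x => ?_)
  rw [tribesFin_update, tribesFin_update, hsplit]
  exact Iff.rfl

/-! ### §4 `1/4 ≤ (1 − 2^{−w})^{2^w} ≤ 1/2` -/

/-- `1/4 ≤ (1 − 1/(2k))^{2k}` for `k ≥ 1`: `(1 − 1/(2k))^k ≥ 1 − k/(2k) = 1/2` (Bernoulli), then square. [folklore] -/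
theorem quarter_le_one_sub_inv_pow {k : ℕ} (hk : 1 ≤ k) : 1 / 4 ≤ (1 - 1 / ((2 * k : ℕ) : ℝ)) ^ (2 * k) := by
  have hk0 : (0 : ℝ) < k := by exact_mod_cast hk
  have hB : (1 : ℝ) / 2 ≤ (1 - 1 / ((2 * k : ℕ) : ℝ)) ^ k := by
    have h := one_add_mul_le_pow (a := - (1 / ((2 * k : ℕ) : ℝ))) ?_ k
    · have hk' : (k : ℝ) * -(1 / ((2 * k : ℕ) : ℝ)) = -(1 / 2) := by
        push_cast; field_simp
      rw [hk'] at h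
      have h' : (1 - 1 / ((2 * k : ℕ) : ℝ)) ^ k = (1 + -(1 / ((2 * k : ℕ) : ℝ))) ^ k := by
        rw [← sub_eq_add_neg]
      rw [h']
      linarith
    · have : 0 ≤ 1 / ((2 * k : ℕ) : ℝ) := by positivity
      have h1 : 1 / ((2 * k : ℕ) : ℝ) ≤ 1 := by
        rw [div_le_one (by positivity)]
        exact_mod_cast (show 1 ≤ 2 * k by omega)
      linarith
  have h0 : (0 : ℝ) ≤ 1 / 2 := by norm_num
  calc (1 : ℝ) / 4 = (1 / 2) ^ 2 := by norm_num
    _ ≤ ((1 - 1 / ((2 * k : ℕ) : ℝ)) ^ k) ^ 2 := pow_le_pow_left₀ h0 hB 2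
    _ = (1 - 1 / ((2 * k : ℕ) : ℝ)) ^ (2 * k) := by rw [← pow_mul, mul_comm]

/-- For `w ≥ 1`: `1/4 ≤ ((2^w − 1)/2^w)^{2^w} ≤ 1/2`. [folklore] -/
theorem tribes_zeroProb_bounds {w : ℕ} (hw : 1 ≤ w) :
    1 / 4 ≤ (((2 ^ w - 1 : ℕ) : ℝ) / (2 : ℝ) ^ w) ^ (2 ^ w) ∧
      (((2 ^ w - 1 : ℕ) : ℝ) / (2 : ℝ) ^ w) ^ (2 ^ w) ≤ 1 / 2 := by
  have h2w : (1 : ℕ) ≤ 2 ^ w := Nat.one_le_two_pow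
  have hq : ((2 ^ w - 1 : ℕ) : ℝ) / (2 : ℝ) ^ w = 1 - 1 / ((2 ^ w : ℕ) : ℝ) := by
    rw [Nat.cast_sub h2w]
    push_cast
    field_simp
  rw [hq]
  refine ⟨?_, ?_⟩
  · obtain ⟨k, hk⟩ : ∃ k, w = k + 1 := ⟨w - 1, by omega⟩
    have h2k : 2 ^ w = 2 * 2 ^ k := by rw [hk, pow_succ, mul_comm]
    rw [h2k]
    exact quarter_le_one_sub_inv_pow Nat.one_le_two_pow
  · have := one_sub_inv_pow_le_half (n := 2 ^ w) h2w
    push_cast at this ⊢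
    exact this

/-! ### §5 The tribes calibrator -/

/-- **THE TRIBES CALIBRATOR of the classical corner.** For every `w ≥ 1`, on `N = 2^w·w` bits there is a polynomial `p`
of degree `≤ N`, `{0,1}`-valued on the cube (the tribes function `Tribes_{w,2^w}`), equal on the cube to a single decision
tree of depth `≤ N` — so a mixture of depth-`≤ T` trees with `T = N` —, with `Var[p] ≥ 3/16` and EVERY influence
`Infᵢ[p] ≤ 2/2^w` (`= 2w/N ≤ 2 log₂N / N`). [cite: ODonnell2014, §4.2] -/
theorem exists_tribes_calibrator {w : ℕ} (hw : 1 ≤ w) :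
    ∃ p : MvPolynomial (Fin (2 ^ w * w)) ℝ, p.totalDegree ≤ 2 ^ w * w ∧
      (∀ x, evalBool p x = 0 ∨ evalBool p x = 1) ∧
      (∃ (m : ℕ) (wt : Fin m → ℝ) (t : Fin m → DecisionTree (2 ^ w * w)),
        (∀ k, 0 ≤ wt k) ∧ ∑ k, wt k = 1 ∧ (∀ k, (t k).depth ≤ 2 ^ w * w) ∧
          ∀ x, evalBool p x = ∑ k, wt k * (if (t k).eval x = true then (1 : ℝ) else 0)) ∧
      3 / 16 ≤ boolVariance p ∧ ∀ i, influence i p ≤ 2 / (2 : ℝ) ^ w := by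
  classical
  set s : ℕ := 2 ^ w with hs
  have hs1 : 1 ≤ s := Nat.one_le_two_pow
  set f : (Fin (s * w) → Bool) → Bool := fun x => tribes s w (fun q => x (finProdFinEquiv q)) with hf
  obtain ⟨p, hdeg, hp, hmix⟩ := exists_mixture_of_boolean f
  refine ⟨p, hdeg, fun x => ?_, hmix, ?_, fun i => ?_⟩
  · rw [hp x]; cases f x <;> simp
  · -- variance: `P0 (1 − P0)` with `1/4 ≤ P0 ≤ 1/2`
    have h2N : (0 : ℝ) < (2 : ℝ) ^ (s * w) := by positivity
    have hcardT : (((Finset.univ.filter fun x => f x = true).card : ℕ) : ℝ) =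
        (2 : ℝ) ^ (s * w) - (((2 ^ w - 1) ^ s : ℕ) : ℝ) := by
      have h := Finset.card_filter_add_card_filter_not
        (s := (Finset.univ : Finset (Fin (s * w) → Bool))) (fun x => f x = true)
      have hF : ((Finset.univ : Finset (Fin (s * w) → Bool)).filter (fun x => ¬ f x = true)).card =
          (2 ^ w - 1) ^ s := by
        rw [← card_filter_tribesFin_eq_false s w]
        congr 1; ext x
        simp only [Finset.mem_filter, Finset.mem_univ, true_and, Bool.not_eq_true, hf]
      rw [hF, Finset.card_univ, Fintype.card_fun, Fintype.card_bool, Fintype.card_fin] at h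
      have h' : ((Finset.univ.filter fun x => f x = true).card : ℕ) = 2 ^ (s * w) - (2 ^ w - 1) ^ s := by omega
      have hle : (2 ^ w - 1) ^ s ≤ 2 ^ (s * w) := by omega
      rw [h', Nat.cast_sub hle]
      push_cast
      ring
    rw [boolVariance_eq_of_boolean p f hp, hcardT]
    set P0 : ℝ := (((2 ^ w - 1) ^ s : ℕ) : ℝ) / (2 : ℝ) ^ (s * w) with hP0
    have hP0eq : P0 = (((2 ^ w - 1 : ℕ) : ℝ) / (2 : ℝ) ^ w) ^ (2 ^ w) := by
      rw [hP0, div_pow, ← pow_mul, ← hs, mul_comm w s]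
      push_cast
      ring
    obtain ⟨hlo, hhi⟩ := tribes_zeroProb_bounds hw
    rw [← hP0eq] at hlo hhi
    have hrew : ((2 : ℝ) ^ (s * w) - (((2 ^ w - 1) ^ s : ℕ) : ℝ)) / (2 : ℝ) ^ (s * w) = 1 - P0 := by
      rw [hP0]; field_simp
    rw [hrew]
    nlinarith
  · -- influences: `#pivotal / 2^N ≤ 2 (2^w)^{s-1} / 2^{s w} = 2 / 2^w`
    have h2N : (0 : ℝ) < (2 : ℝ) ^ (s * w) := by positivity
    rw [influence_eq_card_of_boolean p f hp i, div_le_div_iff₀ h2N (by positivity)]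
    have hle := card_filter_tribesFin_pivotal_le (s := s) (w := w) i
    have hle' : (((Finset.univ : Finset (Fin (s * w) → Bool)).filter
        (fun x => f (update x i true) ≠ f (update x i false))).card : ℝ) ≤ ((2 * (2 ^ w) ^ (s - 1) : ℕ) : ℝ) := by
      exact_mod_cast hle
    have hpow : ((2 * (2 ^ w) ^ (s - 1) : ℕ) : ℝ) * (2 : ℝ) ^ w = 2 * (2 : ℝ) ^ (s * w) := by
      obtain ⟨r, hr⟩ : ∃ r, s = r + 1 := ⟨s - 1, by omega⟩
      rw [hr, Nat.add_sub_cancel]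
      push_cast
      rw [show (r + 1) * w = w * r + w by ring, pow_add, pow_mul]
      ring
    calc (((Finset.univ : Finset (Fin (s * w) → Bool)).filter
            (fun x => f (update x i true) ≠ f (update x i false))).card : ℝ) * (2 : ℝ) ^ w
        ≤ ((2 * (2 ^ w) ^ (s - 1) : ℕ) : ℝ) * (2 : ℝ) ^ w := mul_le_mul_of_nonneg_right hle' (by positivity)
      _ = 2 * (2 : ℝ) ^ (s * w) := hpow

/-- The tribes calibrator is pseudo-bounded of order `N = 2^w·w` (it lies in `R_N ⊆ K_N`): the same witness in the
vocabulary of the crux `PseudoBoundedAA`. [cite: KaniewskiLeeDewolf2015, Def. 7] [cite: ODonnell2014, §4.2] -/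
theorem exists_tribes_calibrator_pseudoBounded {w : ℕ} (hw : 1 ≤ w) :
    ∃ p : MvPolynomial (Fin (2 ^ w * w)) ℝ, PseudoBounded (2 ^ w * w) p ∧
      (∀ x, evalBool p x = 0 ∨ evalBool p x = 1) ∧
      3 / 16 ≤ boolVariance p ∧ ∀ i, influence i p ≤ 2 / (2 : ℝ) ^ w := by
  obtain ⟨p, -, h01, ⟨m, wt, t, hwt, hwt1, htd, hmix⟩, hvar, hinf⟩ := exists_tribes_calibrator hw
  exact ⟨p, ClassicalCorner.pseudoBounded_of_mixture wt hwt hwt1 t _ htd p hmix, h01, hvar, hinf⟩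

end ClassicalCornerCalibration

end Summit.QuantumAdvantage.QuantumAdvantage.Theorems.SosSandwich

end
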